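import Summits.NavierStokesRegularity.TurbBounds.CouetteForm
import Summits.NavierStokesRegularity.TurbBounds.ShearPolyBridge
import Summits.NavierStokesRegularity.TurbBounds.ShearBridgeNormsTF
import HarnessLib

/-!
# The two-field bridge for the Couette rows: the streamwise-invariant spectral-constraint form `rbForm c c g k²` of a POLYNOMIAL pair equals the
# certificates' tracked quadratic forms + Parseval tails + `2Σ_p ĝ_p·cᵀE⁽ᵖ⁾d` + the tail coupling — the right-hand side of `Certs/C…/ModeForm<k>.modeForm_nonneg`
(cell `pub-turb` / `turb-bounds`, shear lane; v2, written by pub-turb-shear gen 7, 2026-08-22; generic `(N, P)`. Depends on cert's generic V2-TAIL files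
(`CouplingSplit`, `LegendreTails`, `LegendreTriple`, `TailPolyGenW`), the staged two-field chain `ShearSpecPiecesTF … ShearBridgeNormsTF` (gen 6, Ca), `CouetteForm`,
`ShearPolyBridge` (window bookkeeping) and `ShearTripleGaunt`.)

HONEST FRAMING: rigorous bounds for the stated PDE and boundary conditions; no claim about physical turbulence beyond the bound.
PROVED (constants `cK, KINV2, K2 : ℚ` with `KINV2·K = 1`, `K2 = K`; profile `g = Σ_{p≤P} ĝ_p P_p`; polynomials `W, Θ` with `W(−1) = W′(−1) = 0`, `Θ(−1) = 0`; window `L > deg W, deg Θ`):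
* `couplingExact_eq_sum_rform`: cert's exact tracked coupling `couplingExact N P ĝ b e` (rbsdp SPEC 3.5 index set `S`) IS `Σ_p ĝ_p·cᵀE⁽ᵖ⁾d` with the literal two-field tables
  (`ShearSpecQFormsTF.bform_tfETab` + ladder dictionaries + `triple n m p = ∫P_nP_mP_p = w_m·T(p,n,m)`: `ShearTripleGaunt` + cert's `integral_legendre_triple`);
* **`rbForm_poly_decomp`**: `rbForm cK cK g K W Θ = cK·(cᵀXWc + W-tails) + cK·(dᵀXTd + Θ-tails) + 2Σ_p ĝ_p·rform(E⁽ᵖ⁾) c d + X_t`, `X_t = tailXTF N P g W Θ = 2∫ g·w̃₀·θ̃₀`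
  (cert's `CouplingSplit.coupling_split`);
* **`tailXTF_bound`**: `|g| ≤ T`, `ε > 0` ⇒ `|X_t| ≤ T·(ε·Σ_{k<L} w b² + (Σ_{k<L} w e²)/ε)` with windows from `N+1` (cert's `coupling_tail_bound` + Parseval) — the hypothesis `hX` of `modeForm_nonneg`.
-/

set_option linter.style.longLine false

noncomputable section

namespace Summit.NavierStokesRegularity.TurbBounds.CouettePolyBridge

open Polynomial intervalIntegral MeasureTheory Set Finset Literature.Analysis.SpecialFunctions
open Summit.NavierStokesRegularity.TurbBounds.LadderTail (w w_pos IsLadder)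
open Summit.NavierStokesRegularity.TurbBounds.LegendreCoeffs
open Summit.NavierStokesRegularity.TurbBounds.LegendreTriple (tripleCoeff integral_legendre_triple)
open Summit.NavierStokesRegularity.TurbBounds.LegendreTails (legTail legTrunc integral_legTail_sq coupling_tail_bound natDegree_legTail_le legCoeff_legTail)
open Summit.NavierStokesRegularity.TurbBounds.CouplingSplit (pairWeight couplingExact coupling_split)
open Summit.NavierStokesRegularity.TurbBounds.TailPolyGenW (rbForm rbIntegrand)
open Summit.NavierStokesRegularity.TurbBounds.ShearPolyBridge (gpOf natDegree_gpOf_le window_shrink legCoeff_zero_beyond)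
open Summit.NavierStokesRegularity.TurbBounds.ShearTripleGaunt (triple_cast_eq_integral)
open Summit.NavierStokesRegularity.TurbBounds.ShearSpecPieces
open Summit.NavierStokesRegularity.TurbBounds.ShearSpecPiecesTF

/-- The tail coupling `X_t = 2∫ g·w̃₀·θ̃₀` (`w̃₀ = legTail N W`, `θ̃₀ = legTail N Θ`: Legendre tails beyond degree `N`). -/
def tailXTF (N P : ℕ) (ghat : ℕ → ℝ) (Wp Θp : ℝ[X]) : ℝ :=
  2 * ∫ x in (-1 : ℝ)..1, (gpOf P ghat).eval x * (legTail N Wp).eval x * (legTail N Θp).eval x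

/-! ## 1. The exact tracked coupling is the literal two-field table form -/

/-- `triple n m p = w_m · T(p, n, m)` (both are `∫ P_p P_n P_m`). -/
theorem triple_eq_w_mul_tripleCoeff (n m p : ℕ) : ((triple n m p : ℚ) : ℝ) = w m * (tripleCoeff p n m : ℝ) := by
  rw [triple_cast_eq_integral, ← integral_legendre_triple]
  exact intervalIntegral.integral_congr fun x _ => by ring

/-- Legendre coefficients of `gpOf P ĝ` below `P + 1` are `ĝ`; hence the pair weights agree. -/
theorem pairWeight_gpOf (P : ℕ) (ghat : ℕ → ℝ) (n m : ℕ) : pairWeight P (legCoeff (gpOf P ghat)) n m = pairWeight P ghat n m := by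
  unfold pairWeight
  refine sum_congr rfl fun p hp => ?_
  unfold gpOf
  rw [legCoeff_expansion, if_pos (by have := mem_range.mp hp; omega)]

/-- **`couplingExact N P ĝ b e = Σ_p ĝ_p·rform(E⁽ᵖ⁾) c d`** for ladders `c → a → b` (both wall relations) and `d → e` (wall relation). -/
theorem couplingExact_eq_sum_rform (N P : ℕ) (ghat : ℕ → ℝ) {c a b d e : ℕ → ℝ}
    (hA : IsLadder c a) (h0a : a 0 = c 0 - c 1 / 3) (hB : IsLadder a b) (h0b : b 0 = a 0 - a 1 / 3)
    (hE : IsLadder d e) (h0e : e 0 = d 0 - d 1 / 3) :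
    couplingExact N P ghat b e = ∑ p ∈ range (P + 1), ghat p * rform (tfETab N P p) (N + P + 3) (N + P + 2) c d := by
  have step : ∀ p, rform (tfETab N P p) (N + P + 3) (N + P + 2) c d
      = ∑ n ∈ range (N + P + 1), ∑ m' ∈ range (N + P + 1), (get2 (tfKTab N P p) n m' : ℝ) * b n * e m' := by
    intro p
    rw [bform_tfETab]
    refine sum_congr rfl fun n hn => sum_congr rfl fun m' hm' => ?_
    rw [lin_tfD0_eq_ladder hA h0a hB h0b n (mem_range.mp hn), lin_tfDT_eq_ladder hE h0e m' (mem_range.mp hm')]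
  simp_rw [step, Finset.mul_sum]
  rw [Finset.sum_comm]
  unfold couplingExact
  refine sum_congr rfl fun n hn => ?_
  rw [Finset.sum_comm]
  refine sum_congr rfl fun m' hm' => ?_
  have hn' := mem_range.mp hn
  have hm'' := mem_range.mp hm'
  by_cases hS : n ≤ N ∨ m' ≤ N
  · rw [if_pos hS]
    simp only [get2_tfKTab, if_pos (And.intro hn' hm''), if_pos hS, triple_eq_w_mul_tripleCoeff]
    unfold pairWeight
    rw [Finset.mul_sum]
    exact sum_congr rfl fun p _ => by ring
  · rw [if_neg hS]
    simp only [get2_tfKTab, if_pos (And.intro hn' hm''), if_neg hS, Rat.cast_zero, zero_mul, mul_zero, sum_const_zero]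

/-! ## 2. The decomposition -/

/-- Linearity bookkeeping for the two-field integrand (continuous data). -/
theorem integral_combTF {u2 u1 u0 t1 t0 g : ℝ → ℝ} (h2 : Continuous u2) (h1 : Continuous u1) (h0 : Continuous u0) (ht1 : Continuous t1)
    (ht0 : Continuous t0) (hg : Continuous g) (cK K : ℝ) :
    ∫ x in (-1 : ℝ)..1, (cK * (16 * u2 x ^ 2 / K + 8 * u1 x ^ 2 + K * u0 x ^ 2) + cK * (4 * t1 x ^ 2 + K * t0 x ^ 2) + 2 * g x * u0 x * t0 x)
      = cK * (16 / K * (∫ x in (-1 : ℝ)..1, u2 x ^ 2) + 8 * (∫ x in (-1 : ℝ)..1, u1 x ^ 2) + K * ∫ x in (-1 : ℝ)..1, u0 x ^ 2)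
        + cK * (4 * (∫ x in (-1 : ℝ)..1, t1 x ^ 2) + K * ∫ x in (-1 : ℝ)..1, t0 x ^ 2)
        + 2 * ∫ x in (-1 : ℝ)..1, g x * u0 x * t0 x := by
  have i2 : IntervalIntegrable (fun x => u2 x ^ 2) volume (-1 : ℝ) 1 := Continuous.intervalIntegrable (by fun_prop) _ _
  have i1 : IntervalIntegrable (fun x => u1 x ^ 2) volume (-1 : ℝ) 1 := Continuous.intervalIntegrable (by fun_prop) _ _
  have i0 : IntervalIntegrable (fun x => u0 x ^ 2) volume (-1 : ℝ) 1 := Continuous.intervalIntegrable (by fun_prop) _ _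
  have j1 : IntervalIntegrable (fun x => t1 x ^ 2) volume (-1 : ℝ) 1 := Continuous.intervalIntegrable (by fun_prop) _ _
  have j0 : IntervalIntegrable (fun x => t0 x ^ 2) volume (-1 : ℝ) 1 := Continuous.intervalIntegrable (by fun_prop) _ _
  have k0 : IntervalIntegrable (fun x => g x * u0 x * t0 x) volume (-1 : ℝ) 1 := Continuous.intervalIntegrable (by fun_prop) _ _
  have e : (fun x => cK * (16 * u2 x ^ 2 / K + 8 * u1 x ^ 2 + K * u0 x ^ 2) + cK * (4 * t1 x ^ 2 + K * t0 x ^ 2) + 2 * g x * u0 x * t0 x)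
      = fun x => (cK * (16 / K)) * u2 x ^ 2 + (cK * 8) * u1 x ^ 2 + (cK * K) * u0 x ^ 2 + (cK * 4) * t1 x ^ 2 + (cK * K) * t0 x ^ 2
          + 2 * (g x * u0 x * t0 x) := by
    funext x; ring
  rw [e]
  rw [intervalIntegral.integral_add ((((((i2.const_mul _).add (i1.const_mul _)).add (i0.const_mul _)).add (j1.const_mul _)).add (j0.const_mul _))) (k0.const_mul _),
    intervalIntegral.integral_add ((((i2.const_mul _).add (i1.const_mul _)).add (i0.const_mul _)).add (j1.const_mul _)) (j0.const_mul _),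
    intervalIntegral.integral_add (((i2.const_mul _).add (i1.const_mul _)).add (i0.const_mul _)) (j1.const_mul _),
    intervalIntegral.integral_add ((i2.const_mul _).add (i1.const_mul _)) (i0.const_mul _),
    intervalIntegral.integral_add (i2.const_mul _) (i1.const_mul _)]
  simp only [intervalIntegral.integral_const_mul]
  ring

/-- `legTail N F = ShearCoupling.tailFrom (N+1) F` (both: `F − Σ_{k ≤ N} ĉ_k P_k`). -/
theorem legTail_eq_tailFrom (N : ℕ) (F : ℝ[X]) : legTail N F = ShearCoupling.tailFrom (N + 1) F := rfl

/-- **The two-field bridge identity** (see the file header). -/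
theorem rbForm_poly_decomp (N P : ℕ) (cK KINV2 K2 : ℚ) {K : ℝ} (hK : K ≠ 0) (hKinv : (KINV2 : ℝ) = 1 / K) (hK2 : (K2 : ℝ) = K)
    (ghat : ℕ → ℝ) (Wp Θp : ℝ[X]) (hW0 : Wp.eval (-1) = 0) (hW1 : (derivative Wp).eval (-1) = 0) (hΘ0 : Θp.eval (-1) = 0)
    (L : ℕ) (hLW : Wp.natDegree < L) (hLΘ : Θp.natDegree < L) :
    rbForm (cK : ℝ) (cK : ℝ) (fun x => (gpOf P ghat).eval x) K (fun x => Wp.eval x) (fun x => Θp.eval x)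
      = (cK : ℝ) * (qform (xwTab N P KINV2 K2) (N + P + 3) (legCoeff (derivative (derivative Wp)))
            + (16 * (KINV2 : ℝ) * ∑ k ∈ range L, w (N + P + 3 + k) * legCoeff (derivative (derivative Wp)) (N + P + 3 + k) ^ 2
               + 8 * ∑ k ∈ range L, w (N + P + 2 + k) * legCoeff (derivative Wp) (N + P + 2 + k) ^ 2
               + (K2 : ℝ) * ∑ k ∈ range L, w (N + P + 1 + k) * legCoeff Wp (N + P + 1 + k) ^ 2))
        + (cK : ℝ) * (qform (xtTab N P K2) (N + P + 2) (legCoeff (derivative Θp))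
            + (4 * ∑ k ∈ range L, w (N + P + 2 + k) * legCoeff (derivative Θp) (N + P + 2 + k) ^ 2
               + (K2 : ℝ) * ∑ k ∈ range L, w (N + P + 1 + k) * legCoeff Θp (N + P + 1 + k) ^ 2))
        + 2 * ∑ p ∈ range (P + 1), ghat p * rform (tfETab N P p) (N + P + 3) (N + P + 2) (legCoeff (derivative (derivative Wp))) (legCoeff (derivative Θp))
        + tailXTF N P ghat Wp Θp := by
  -- derivatives of polynomial functions
  have dW : deriv (fun x => Wp.eval x) = fun x => (derivative Wp).eval x := by funext x; exact Polynomial.deriv Wp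
  have dW1 : deriv (fun x => (derivative Wp).eval x) = fun x => (derivative (derivative Wp)).eval x := by
    funext x; exact Polynomial.deriv (derivative Wp)
  have dΘ : deriv (fun x => Θp.eval x) = fun x => (derivative Θp).eval x := by funext x; exact Polynomial.deriv Θp
  unfold rbForm rbIntegrand
  simp only [dW, dW1, dΘ]
  rw [integral_combTF (Polynomial.continuous _) (Polynomial.continuous _) (Polynomial.continuous _) (Polynomial.continuous _)
    (Polynomial.continuous _) (Polynomial.continuous _)]
  -- norm splits (larger window L' = N + P + 3 + L)
  have hdW : (derivative Wp).natDegree < L := lt_of_le_of_lt (natDegree_derivative_le Wp) (lt_of_le_of_lt (Nat.sub_le _ _) hLW)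
  have hW := normsW_split N P KINV2 K2 Wp hW0 hW1 (N + P + 3 + L) (by omega) (by omega)
  rw [show N + P + 3 + L - (N + P + 3) = L by omega, show N + P + 3 + L - (N + P + 2) = L + 1 by omega,
    show N + P + 3 + L - (N + P + 1) = L + 2 by omega,
    window_shrink _ (N + P + 2) L 1 (legCoeff_zero_beyond _ hdW _), window_shrink _ (N + P + 1) L 2 (legCoeff_zero_beyond _ hLW _)] at hW
  have hdΘ : (derivative Θp).natDegree < L := lt_of_le_of_lt (natDegree_derivative_le Θp) (lt_of_le_of_lt (Nat.sub_le _ _) hLΘ)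
  have hΘ := normsT_split N P K2 Θp hΘ0 (N + P + 3 + L) (by omega) (by omega)
  rw [show N + P + 3 + L - (N + P + 2) = L + 1 by omega, show N + P + 3 + L - (N + P + 1) = L + 2 by omega,
    window_shrink _ (N + P + 2) L 1 (legCoeff_zero_beyond _ hdΘ _), window_shrink _ (N + P + 1) L 2 (legCoeff_zero_beyond _ hLΘ _)] at hΘ
  -- the coupling
  have hX := coupling_split N P (gpOf P ghat) Wp Θp (natDegree_gpOf_le P ghat)
  have hA : IsLadder (legCoeff (derivative (derivative Wp))) (legCoeff (derivative Wp)) := isLadder_legCoeff (derivative Wp) hW1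
  have h0a := legCoeff_zero_of_wall (derivative Wp) hW1
  have hB : IsLadder (legCoeff (derivative Wp)) (legCoeff Wp) := isLadder_legCoeff Wp hW0
  have h0b := legCoeff_zero_of_wall Wp hW0
  have hE : IsLadder (legCoeff (derivative Θp)) (legCoeff Θp) := isLadder_legCoeff Θp hΘ0
  have h0e := legCoeff_zero_of_wall Θp hΘ0
  have hfin : couplingExact N P (legCoeff (gpOf P ghat)) (legCoeff Wp) (legCoeff Θp)
      = ∑ p ∈ range (P + 1), ghat p * rform (tfETab N P p) (N + P + 3) (N + P + 2) (legCoeff (derivative (derivative Wp))) (legCoeff (derivative Θp)) := by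
    have e1 : couplingExact N P (legCoeff (gpOf P ghat)) (legCoeff Wp) (legCoeff Θp) = couplingExact N P ghat (legCoeff Wp) (legCoeff Θp) := by
      unfold couplingExact
      exact sum_congr rfl fun n _ => sum_congr rfl fun m _ => by rw [pairWeight_gpOf]
    rw [e1, couplingExact_eq_sum_rform N P ghat hA h0a hB h0b hE h0e]
  -- the pieces 16/K = 16·KINV2 and K = K2
  have e16 : (16 : ℝ) / K = 16 * (KINV2 : ℝ) := by rw [hKinv]; field_simp
  rw [e16, ← hK2]
  unfold tailXTF
  rw [hfin] at hX
  linear_combination (cK : ℝ) * hW + (cK : ℝ) * hΘ + 2 * hX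

/-! ## 3. The tail-coupling bound in window form -/

/-- **`|X_t| ≤ T·(ε·Σ_{k<L} w_{N+1+k} b_{N+1+k}² + (Σ_{k<L} w_{N+1+k} e_{N+1+k}²)/ε)`** whenever `|g| ≤ T` on `[−1, 1]`, `ε > 0`, `L > deg W, deg Θ`. -/
theorem tailXTF_bound (N P : ℕ) (ghat : ℕ → ℝ) (Wp Θp : ℝ[X]) {T : ℝ} (hT : ∀ x ∈ Icc (-1 : ℝ) 1, |(gpOf P ghat).eval x| ≤ T)
    (L : ℕ) (hLW : Wp.natDegree < L) (hLΘ : Θp.natDegree < L) {ε : ℝ} (hε : 0 < ε) :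
    |tailXTF N P ghat Wp Θp|
      ≤ T * (ε * ∑ k ∈ range L, w (N + 1 + k) * legCoeff Wp (N + 1 + k) ^ 2
          + (∑ k ∈ range L, w (N + 1 + k) * legCoeff Θp (N + 1 + k) ^ 2) / ε) := by
  have h := coupling_tail_bound (g := fun x => (gpOf P ghat).eval x) (u := fun x => (legTail N Wp).eval x) (v := fun x => (legTail N Θp).eval x)
    (gpOf P ghat).continuous (Polynomial.continuous _) (Polynomial.continuous _) hT hε
  have eu : (∫ x in (-1 : ℝ)..1, (legTail N Wp).eval x ^ 2) = ∑ k ∈ range L, w (N + 1 + k) * legCoeff Wp (N + 1 + k) ^ 2 := by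
    rw [legTail_eq_tailFrom]; exact ShearCoupling.integral_tailFrom_sq (N + 1) Wp (L := L) (by omega)
  have ev : (∫ x in (-1 : ℝ)..1, (legTail N Θp).eval x ^ 2) = ∑ k ∈ range L, w (N + 1 + k) * legCoeff Θp (N + 1 + k) ^ 2 := by
    rw [legTail_eq_tailFrom]; exact ShearCoupling.integral_tailFrom_sq (N + 1) Θp (L := L) (by omega)
  rw [eu, ev] at h
  unfold tailXTF
  rw [show ε⁻¹ * (∑ k ∈ range L, w (N + 1 + k) * legCoeff Θp (N + 1 + k) ^ 2)
      = (∑ k ∈ range L, w (N + 1 + k) * legCoeff Θp (N + 1 + k) ^ 2) / ε by rw [inv_mul_eq_div]] at h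
  exact h

end Summit.NavierStokesRegularity.TurbBounds.CouettePolyBridge

end
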